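import Literature.NumberTheory.EllipticCurves.ThreeTorsionDescentValuation
import Literature.NumberTheory.EllipticCurves.CubeClassRatSupport
import HarnessLib

/-!
# The `3`-descent box of the carrier `y² − 21xy + 6137y = x³`: the descent classes of its rational points
# lie in `{[17^a 19^b] : a, b < 3}`, and `[17]`, `[17²·19]` are attained (Cohen–Pazuki, Thm. 2.1, `D = 1`)

[topic NumberTheory/EllipticCurves]

The curve. `E : y² − 21xy + 6137y = x³` (Kubert's `ℤ/6ℤ`-curve at `c = −19/36`, rank `2`, `t_2 = 0`:
`Curve6137TwoIsogenyDescent`) is, after completing the square, the three-torsion model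
`W = threeTorsionModel (−21/2) (6137/2) : y² = x³ + (−(21/2)x + 6137/2)²` of `ThreeIsogeny`, with
rational `3`-torsion point `T = (0, 6137/2)`; `6137 = 17·19²`.

Cohen–Pazuki's `3`-descent map `α : (x, y) ↦ y − (mx + s)` (tree `ThreeTorsionDescent.descent`, Def. 1.3 of
[CohenPazuki2009] for `D = 1`) on `W(ℚ)`: by Theorem 2.1 (2)–(3) («we can choose `u ∈ ℤ` and cubefree …
`u ∣ (2b)²`», `2b = 6137`), the tree's valuation theorem `Valuation.three_dvd_log_threeTorsionDescent` and
the `S`-unit reduction `cubeClass_eq_prod_of_support`: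

* `three_dvd_padicValRat_descent` — `3 ∣ v_p(α(P))` for every prime `p ∉ {17, 19}` and every `P ∈ W(ℚ)`;
* **`descentClass_mem_box`** — `[α(P)] ∈ {[17^a·19^b] : a, b < 3}` for every `P ∈ W(ℚ)`: the image of
  `α` lies in a box of `9` classes (`dim_{𝔽₃} ≤ 2 = ω(6137)`);
* the box is HIT: `descentClass_T` (`[α(T)] = [6137²] = [17²·19]`), `descentClass_negT` (`[α(−T)] = [17·19²]`),
  **`descentClass_P₁`** for the rational point `P₁ = (−357, 986)` (`α(P₁) = −5831 = 17·(−7)³`, class `[17]`)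
  — `[17]` and `[17²·19]` generate the whole box, so the `φ̂`-side of the `3`-isogeny descent of this curve
  is SHARP (image = box; Cohen–Pazuki Prop. 2.2: `|Im α|·|Im α̂| = 3^{r+1} = 27` then forces `|Im α̂| = 3`).

This is the `E`-side half of the door at `3` on the cross-prime carrier of route ShaPrimaryTransfer; the
`Ê`-side (classes in `ℚ(ζ₃)*/ℚ(ζ₃)*³` of cube norm, `ThreeTorsionDescentCodomain`) and the passage from
sharp boxes to `Ш(E)[3] = 0` are the sequel. No named facts; everything proved.

## References

* [CohenPazuki2009] H. Cohen, F. Pazuki, Acta Arith. 140 (2009): Definition 1.3, Theorem 2.1, Proposition 2.2.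
* [Kubert1976] D. S. Kubert, Proc. LMS 33 (1976), Table 3 (the `ℤ/6ℤ` family).
* Tree: `ThreeIsogeny` (`threeTorsionModel`), `ThreeTorsionDescentHom`, `ThreeTorsionDescentValuation`,
  `CubeClassRatSupport`, `Curve6137TwoIsogenyDescent`.
-/

noncomputable section

open scoped Classical

namespace Literature.NumberTheory.EllipticCurves

namespace Carrier6137

open _root_.WeierstrassCurve ThreeTorsionDescent MordellDescent

/-! ## 0. The three-torsion model -/

/-- `W = threeTorsionModel (−21/2) (6137/2)` is an elliptic curve (`16s³(4m³ − 27s) ≠ 0`).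
[cite: CohenPazuki2009, §1 (discriminant 16b³D²(4Da³ − 27b))] -/
theorem isElliptic_W : (threeTorsionModel (-21 / 2 : ℚ) (6137 / 2)).IsElliptic :=
  (isElliptic_threeTorsionModel_iff _ _).mpr (by norm_num)

/-- A rational solution of `y² = x³ + (mx + s)²` is a nonsingular point of `W`. [folklore] -/
private theorem nonsingular_of_eq {x y : ℚ}
    (h : y ^ 2 = x ^ 3 + (-21 / 2) ^ 2 * x ^ 2 + 2 * (-21 / 2) * (6137 / 2) * x + (6137 / 2) ^ 2) :
    (threeTorsionModel (-21 / 2 : ℚ) (6137 / 2)).toAffine.Nonsingular x y := by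
  haveI := isElliptic_W
  exact Affine.equation_iff_nonsingular.mp ((ThreeTorsionDescent.equation_iff_of_eq rfl x y).mpr h)

/-! ## 1. The box: `[α(P)] ∈ {[17^a 19^b]}` -/

/-- **`3 ∣ v_p(α(P))` for every prime `p ≠ 17, 19`** and every rational point `P` of `W` (`2s = 6137 = 17·19²`
is a `p`-unit, `2m = −21 ∈ ℤ`). [cite: CohenPazuki2009, Theorem 2.1 (2)] -/
theorem three_dvd_padicValRat_descent (p : ℕ) [hp : Fact p.Prime] (h17 : p ≠ 17) (h19 : p ≠ 19)
    (P : (threeTorsionModel (-21 / 2 : ℚ) (6137 / 2)).toAffine.Point) :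
    (3 : ℤ) ∣ padicValRat p (descent (threeTorsionModel (-21 / 2 : ℚ) (6137 / 2)) (-21 / 2) (6137 / 2) P) := by
  have h2s : (2 : ℚ) * (6137 / 2) ≠ 0 := by norm_num
  have hne := descent_ne_zero (W := threeTorsionModel (-21 / 2 : ℚ) (6137 / 2)) (m := -21 / 2) h2s P
  rw [← three_dvd_padicValRat_iff_log hne]
  refine (Rat.padicValuation p).three_dvd_log_threeTorsionDescent rfl ?_ ?_ P
  · -- `v_p(6137) = 0`
    rw [show (2 : ℚ) * (6137 / 2) = ((6137 : ℕ) : ℚ) by norm_num,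
      padicValuation_eq_one_iff (by norm_num), padicValRat.of_nat, Nat.cast_eq_zero]
    refine padicValNat.eq_zero_of_not_dvd fun hd => ?_
    have h' : p ∣ 17 * 19 ^ 2 := by simpa using hd
    rcases (Nat.Prime.dvd_mul hp.out).mp h' with h1 | h1
    · exact h17 ((Nat.prime_dvd_prime_iff_eq hp.out (by decide)).mp h1)
    · exact h19 ((Nat.prime_dvd_prime_iff_eq hp.out (by decide)).mp (hp.out.dvd_of_dvd_pow h1))
  · -- `v_p(−21) ≥ 0`
    rw [show (2 : ℚ) * (-21 / 2) = ((-21 : ℤ) : ℚ) by norm_num, padicValuation_le_one_iff (by norm_num),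
      padicValRat.of_int]
    exact_mod_cast Nat.zero_le _

/-- **The `3`-descent box of the carrier**: for every `P ∈ W(ℚ)`, `[α(P)] = [17^a·19^b]` with `a, b < 3`
(Cohen–Pazuki: «`u` cubefree with `u ∣ (2b)²`», `2b = 6137 = 17·19²`). [cite: CohenPazuki2009, Theorem 2.1 (3)] -/
theorem descentClass_mem_box (P : (threeTorsionModel (-21 / 2 : ℚ) (6137 / 2)).toAffine.Point) :
    ∃ a b : ℕ, a < 3 ∧ b < 3 ∧
      descentClass (threeTorsionModel (-21 / 2 : ℚ) (6137 / 2)) (-21 / 2) (6137 / 2) P =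
        cubeClass ((17 : ℚ) ^ a * 19 ^ b) := by
  have h2s : (2 : ℚ) * (6137 / 2) ≠ 0 := by norm_num
  have hne := descent_ne_zero (W := threeTorsionModel (-21 / 2 : ℚ) (6137 / 2)) (m := -21 / 2) h2s P
  have hS : ∀ p ∈ ({17, 19} : Finset ℕ), p.Prime := by
    intro p hp
    simp only [Finset.mem_insert, Finset.mem_singleton] at hp
    rcases hp with rfl | rfl <;> decide
  obtain ⟨e, he, hcl⟩ := cubeClass_eq_prod_of_support {17, 19} hS hne (fun p hp hpS => by
    haveI : Fact p.Prime := ⟨hp⟩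
    have h17 : p ≠ 17 := fun h => hpS (by simp [h])
    have h19 : p ≠ 19 := fun h => hpS (by simp [h])
    exact three_dvd_padicValRat_descent p h17 h19 P)
  refine ⟨e 17, e 19, he 17, he 19, ?_⟩
  rw [descentClass, hcl, Finset.prod_pair (by norm_num)]
  push_cast
  rfl

/-! ## 2. The box is hit: `T`, `−T`, and the point `(−357, 986)` -/

/-- `[α(T)] = [6137²] = [17²·19]` for the `3`-torsion point `T = (0, 6137/2)`.
[cite: CohenPazuki2009, Definition 1.3 (α((0,b)) = 1/(2b))] -/
theorem descentClass_T :
    descentClass (threeTorsionModel (-21 / 2 : ℚ) (6137 / 2)) (-21 / 2) (6137 / 2)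
        (.some 0 (6137 / 2) (nonsingular_of_eq (by norm_num))) = cubeClass ((17 : ℚ) ^ 2 * 19) := by
  rw [descentClass, descent_some_of_eq (-21 / 2) (6137 / 2) _ (by norm_num),
    show ((2 : ℚ) * (6137 / 2)) ^ 2 = (17 ^ 2 * 19) * 19 ^ 3 by norm_num,
    cubeClass_mul_pow_three (by norm_num) (by norm_num)]

/-- `[α(−T)] = [−6137] = [17·19²]` for `−T = (0, −6137/2)`. [cite: CohenPazuki2009, Definition 1.3] -/
theorem descentClass_negT :
    descentClass (threeTorsionModel (-21 / 2 : ℚ) (6137 / 2)) (-21 / 2) (6137 / 2)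
        (.some 0 (-(6137 / 2)) (nonsingular_of_eq (by norm_num))) = cubeClass ((17 : ℚ) * 19 ^ 2) := by
  rw [descentClass, descent_some_of_ne (-21 / 2) (6137 / 2) _ (by norm_num),
    show (-(6137 / 2) - (-21 / 2) * 0 - 6137 / 2 : ℚ) = -(17 * 19 ^ 2) by norm_num, cubeClass_neg]

/-- **`[α(P₁)] = [17]` for the rational point `P₁ = (−357, 986)`**: `α(P₁) = 986 − ((−21/2)(−357) + 6137/2)
= −5831 = 17·(−7)³`. With `[α(T)] = [17²·19]` the classes of rational points generate the whole box
`{[17^a 19^b]}`: the `E`-side of the `3`-isogeny descent of the carrier is sharp. [cite: CohenPazuki2009, Theorem 2.1 and Proposition 2.2] -/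
theorem descentClass_P₁ :
    descentClass (threeTorsionModel (-21 / 2 : ℚ) (6137 / 2)) (-21 / 2) (6137 / 2)
        (.some (-357) 986 (nonsingular_of_eq (by norm_num))) = cubeClass (17 : ℚ) := by
  rw [descentClass, descent_some_of_ne (-21 / 2) (6137 / 2) _ (by norm_num),
    show (986 - (-21 / 2) * (-357) - 6137 / 2 : ℚ) = 17 * (-7) ^ 3 by norm_num,
    cubeClass_mul_pow_three (by norm_num) (by norm_num)]

end Carrier6137

end Literature.NumberTheory.EllipticCurves
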